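import Mathlib

/-!
# T5CyclicSubfields — N2.8.2(a): the subfields of a cyclic sextic Galois extension

Kernel witness (cell pub-hodge-repro2, seat p3, Tier-5 support for sub-step N2) for the one-line
[A] of route/T5-N2-route-3.md §N2.8.2(a):

«Gal(E/ℚ) is CYCLIC of order 6: complex conjugation is a central involution of Gal(E/ℚ) (E is CM
and Galois), and S₃ has no central involution — so F⁺ is the cyclic cubic and K the unique
quadratic subfield, imaginary».

The cyclicity itself is p1's `GaloisSextic.lean` (p386646: `isCyclic_gal_of_finrank_six`). This
file is the SECOND half of the line — what cyclicity gives for the subfields: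

* `pow_card_eq_one_of_mem`, `coe_eq_setOf_pow_eq_one`, `Subgroup.eq_of_card_eq_of_isCyclic`: in a
  finite cyclic group a subgroup of order `n` is the solution set of `x ^ n = 1` (Lagrange +
  Mathlib `IsCyclic.card_pow_eq_one_le`), so a subgroup is determined by its order; and
  `exists_subgroup_card_eq_of_dvd`: every divisor of the order occurs.
* `IntermediateField.eq_of_finrank_eq_of_isCyclic`: in a finite Galois extension `E / F` with
  cyclic Galois group, an intermediate field is determined by its degree (Galois correspondence,
  Mathlib `IsGalois.fixedField_fixingSubgroup` + `card_fixingSubgroup_eq_finrank`);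
  `exists_intermediateField_finrank_eq_of_dvd`: every divisor of `[E : F]` occurs;
  `existsUnique_intermediateField_finrank_eq`: exactly one intermediate field of each degree
  `d ∣ [E : F]` — for `[E : F] = 6` this is «F⁺ is THE cyclic cubic» (`d = 3`) and «K THE
  unique quadratic subfield» (`d = 2`).
* `not_mem_of_orderOf_eq_two_of_card_eq_three`, `exists_not_fixed_of_orderOf_eq_two`: an element
  of order `2` of the Galois group of a sextic extension (complex conjugation) lies in no subgroup
  of order `3` (Lagrange), hence does not fix the quadratic subfield pointwise — «K imaginary»
  (the reading «c acts non-trivially on K» of «imaginary», prose).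

README §8(d): this file uses an L-value-free non-vanishing device: NO.
-/

namespace Summit.Ventures.HodgeRepro2.T5CyclicSubfields

open Module IntermediateField

section Group

/-- Lagrange: an element of a subgroup `H` satisfies `x ^ |H| = 1`. -/
theorem pow_card_eq_one_of_mem {G : Type*} [Group G] {H : Subgroup G} {x : G} (hx : x ∈ H) :
    x ^ Nat.card H = 1 := by
  have h := pow_card_eq_one' (G := H) (x := ⟨x, hx⟩)
  have := congrArg Subtype.val h
  rwa [Subgroup.coe_pow, OneMemClass.coe_one] at this

variable {G : Type*} [Group G] [IsCyclic G] [Finite G]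

/-- In a finite cyclic group, a subgroup of order `n` is exactly the set of solutions of
`x ^ n = 1` (Lagrange gives `⊆`; a cyclic group has at most `n` such solutions, Mathlib
`IsCyclic.card_pow_eq_one_le`). -/
theorem coe_eq_setOf_pow_eq_one (H : Subgroup G) :
    (H : Set G) = {x : G | x ^ Nat.card H = 1} := by
  classical
  haveI := Fintype.ofFinite G
  have hn : 0 < Nat.card H := Nat.card_pos
  have hsub : (H : Set G) ⊆ {x : G | x ^ Nat.card H = 1} := fun x hx => pow_card_eq_one_of_mem hx
  have hcardH : (H : Set G).ncard = Nat.card H := by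
    rw [← Nat.card_coe_set_eq]
    rfl
  have hle : ({x : G | x ^ Nat.card H = 1} : Set G).ncard ≤ (H : Set G).ncard := by
    rw [hcardH, Set.ncard_eq_toFinset_card']
    have h1 : ({x : G | x ^ Nat.card H = 1} : Set G).toFinset =
        Finset.univ.filter (fun a : G => a ^ Nat.card H = 1) := by
      ext a
      simp
    rw [h1]
    exact IsCyclic.card_pow_eq_one_le hn
  exact Set.eq_of_subset_of_ncard_le hsub hle

/-- Two subgroups of a finite cyclic group with the same order are equal. -/
theorem Subgroup.eq_of_card_eq_of_isCyclic {H₁ H₂ : Subgroup G} (h : Nat.card H₁ = Nat.card H₂) :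
    H₁ = H₂ := by
  apply SetLike.coe_injective
  rw [coe_eq_setOf_pow_eq_one H₁, coe_eq_setOf_pow_eq_one H₂, h]

/-- Every divisor of the order of a finite cyclic group is the order of a subgroup. -/
theorem exists_subgroup_card_eq_of_dvd {d : ℕ} (hd : d ∣ Nat.card G) :
    ∃ H : Subgroup G, Nat.card H = d := by
  obtain ⟨g, hg⟩ := IsCyclic.exists_ofOrder_eq_natCard (α := G)
  have hg0 : orderOf g ≠ 0 := by rw [hg]; exact Nat.card_pos.ne'
  have hd' : d ∣ orderOf g := by rwa [hg]
  refine ⟨Subgroup.zpowers (g ^ (orderOf g / d)), ?_⟩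
  rw [Nat.card_zpowers, orderOf_pow_orderOf_div hg0 hd']

end Group

section Lagrange

/-- An element of order `2` lies in no subgroup of order `3` (Lagrange). -/
theorem not_mem_of_orderOf_eq_two_of_card_eq_three {G : Type*} [Group G] {c : G}
    (hc : orderOf c = 2) {H : Subgroup G} (hH : Nat.card H = 3) : c ∉ H := by
  intro hcH
  have h := orderOf_dvd_natCard (⟨c, hcH⟩ : H)
  rw [Subgroup.orderOf_mk, hc, hH] at h
  norm_num at h

end Lagrange

section Galois

variable {F E : Type*} [Field F] [Field E] [Algebra F E] [FiniteDimensional F E] [IsGalois F E]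

/-- In a finite Galois extension with cyclic Galois group, an intermediate field is determined by
its degree over the base field. -/
theorem IntermediateField.eq_of_finrank_eq_of_isCyclic [IsCyclic (E ≃ₐ[F] E)]
    {K₁ K₂ : IntermediateField F E} (h : finrank F K₁ = finrank F K₂) : K₁ = K₂ := by
  have h1 : finrank K₁ E = finrank K₂ E := by
    have t1 := Module.finrank_mul_finrank F K₁ E
    have t2 := Module.finrank_mul_finrank F K₂ E
    rw [h] at t1
    have hpos : 0 < finrank F K₂ := Module.finrank_pos
    exact Nat.eq_of_mul_eq_mul_left hpos (t1.trans t2.symm)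
  have h2 : Nat.card (fixingSubgroup K₁) = Nat.card (fixingSubgroup K₂) := by
    rw [IsGalois.card_fixingSubgroup_eq_finrank, IsGalois.card_fixingSubgroup_eq_finrank, h1]
  have h3 : fixingSubgroup K₁ = fixingSubgroup K₂ := Subgroup.eq_of_card_eq_of_isCyclic h2
  rw [← IsGalois.fixedField_fixingSubgroup K₁, ← IsGalois.fixedField_fixingSubgroup K₂, h3]

/-- In a finite Galois extension with cyclic Galois group, every divisor of `[E : F]` is the
degree of an intermediate field. -/
theorem exists_intermediateField_finrank_eq_of_dvd [IsCyclic (E ≃ₐ[F] E)] {d : ℕ}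
    (hd : d ∣ finrank F E) : ∃ K : IntermediateField F E, finrank F K = d := by
  have hN : Nat.card (E ≃ₐ[F] E) = finrank F E := IsGalois.card_aut_eq_finrank F E
  have hm : finrank F E / d ∣ Nat.card (E ≃ₐ[F] E) := by
    rw [hN]; exact Nat.div_dvd_of_dvd hd
  obtain ⟨H, hH⟩ := exists_subgroup_card_eq_of_dvd hm
  refine ⟨fixedField H, ?_⟩
  have hKE : finrank (fixedField H) E = finrank F E / d := by
    rw [IntermediateField.finrank_fixedField_eq_card, hH]
  have ht := Module.finrank_mul_finrank F (fixedField H) E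
  rw [hKE] at ht
  have hd' : d * (finrank F E / d) = finrank F E := Nat.mul_div_cancel' hd
  have hpos : 0 < finrank F E / d := by
    rcases Nat.eq_zero_or_pos (finrank F E / d) with h0 | h0
    · rw [h0, mul_zero] at hd'
      exact absurd hd'.symm Module.finrank_pos.ne'
    · exact h0
  exact Nat.eq_of_mul_eq_mul_right hpos (ht.trans hd'.symm)

/-- Exactly one intermediate field of each degree `d ∣ [E : F]` in a cyclic Galois extension:
for `[E : F] = 6`, «F⁺ is THE cyclic cubic» (`d = 3`) and «K THE unique quadratic subfield»
(`d = 2`). -/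
theorem existsUnique_intermediateField_finrank_eq [IsCyclic (E ≃ₐ[F] E)] {d : ℕ}
    (hd : d ∣ finrank F E) : ∃! K : IntermediateField F E, finrank F K = d := by
  obtain ⟨K, hK⟩ := exists_intermediateField_finrank_eq_of_dvd hd
  exact ⟨K, hK, fun K' hK' => IntermediateField.eq_of_finrank_eq_of_isCyclic (hK'.trans hK.symm)⟩

/-- «K imaginary»: in a Galois extension of degree `6`, an element `c` of the Galois group of
order `2` (complex conjugation) does not fix a quadratic intermediate field `K` pointwise — its
fixing subgroup has order `3`, which cannot contain `c` (Lagrange). -/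
theorem exists_not_fixed_of_orderOf_eq_two (h6 : finrank F E = 6) {c : E ≃ₐ[F] E}
    (hc : orderOf c = 2) {K : IntermediateField F E} (hK : finrank F K = 2) :
    ∃ x ∈ K, c x ≠ x := by
  have hKE : finrank K E = 3 := by
    have ht := Module.finrank_mul_finrank F K E
    rw [hK, h6] at ht
    omega
  have hcard : Nat.card (fixingSubgroup K) = 3 := by
    rw [IsGalois.card_fixingSubgroup_eq_finrank, hKE]
  have hnot := not_mem_of_orderOf_eq_two_of_card_eq_three hc hcard
  rw [IntermediateField.mem_fixingSubgroup_iff] at hnot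
  push Not at hnot
  exact hnot

end Galois

end Summit.Ventures.HodgeRepro2.T5CyclicSubfields
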